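import Summits.ResolutionOfSingularities.ResolutionOfSingularities.Theorems.FrobeniusLadderFInjectiveMacaulayficationLoopGermMCharts
import Summits.ResolutionOfSingularities.ResolutionOfSingularities.Theorems.FrobeniusLadderFInjectiveMacaulayficationLoopGermLCure
import Summits.ResolutionOfSingularities.ResolutionOfSingularities.Theorems.FrobeniusLadderFInjectiveMacaulayficationPointFixableTransport
import HarnessLib

/-!
# (O-3)(iii) `Bl_{(a,c,e)} U_M` IN THE KERNEL: the `a`-chart IS `U_L`, the charts `c`, `e` are cured
# (crux `FInjectiveMacaulayfication` stmt-ResolutionOfSingularities-15315, chain w45a; res-L1-w45a-plan-1 g19 RULING R19.18 (iii); seat res-L1-w45a-stub-3 g10)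

[OURS · L1 W4.5a] Support file (`--supports stmt-ResolutionOfSingularities-15315 --as helper`); unconditional; def-free; replaces the role of NO printed item;
NOT a statement of the manuscript; AI-written (AI review is weaker than expert review). Sequel of `…LoopGermMCharts` and `…LoopGermLCure` (✓ p642873).

`U_M = Spec k[a,b,c,d,e]/(M)`, `M = e² + a²ce + ac² + a²cd² + ab³c²` (`a,…,e = X0,…,X4`), `𝓚_M = (ā, c̄, ē)` (the singular plane `= rad τ(M)`, evidence-level).
As for `L` (`…LoopGermLCure`), the chart identification runs in the presentation `k₀[a,c,e]`, `k₀ = k[b,d]` (generic coefficient domain `A ∋ b, d` in §1, so that no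
nested polynomial ring is localised in a statement), and is moved to the `k[X]`-presentation by `PointFixableTransport.exists_blowupAlgebra_congr'` (§3).
* §1 (generic `A`, and ANY presentation `R₅ ≅ A[a,c,e]/(M)` of the base — so that the `k[X]`-presentation is reached inside the generic lemma): `theta`, `prime_G`,
  ★ `exists_chart_equiv` (`blowupAlgebra I₅ x₅ ≃ A[a,c,e]/(M_j)`: `StrictTransformChartN.exists_ringEquiv` ∘ `ReesChartFacts.exists_reesChartEquiv` ∘
  `PointFixableTransport.exists_blowupAlgebra_congr'`), ★ `hon_chart` (the clause on `blowupAlgebra I₅ x₅` from a clause on `A[a,c,e]/(M_j)`).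
* §2 (`A = k[b,d]`): `exists_flatten`, `flatten_values` (`Φ M = M`, `Φ M_a = L` — LITERALLY `…LoopGermLCharts`' `L` —, `Φ M_c`, `Φ M_e` = `…LoopGermMCharts`),
  `exists_presentationEquiv`, `prime_F`, `not_mem_span_X`.
* §3 (`k[X]`-presentation `U_M = Spec k[X]/(M)`, centre `span {x̄0, x̄2, x̄4}`): ★★★ `exists_chartA_equiv : ∃ e : blowupAlgebra 𝓚_M x̄0 ≃+* k[X]/(L)` — THE `a`-CHART OF THE
  FIRST BLOW-UP OF `U_M` IS `U_L` (the loop `M → L` in the kernel; `U_L` is then cured by `…LoopGermLCureFin5.loopGerm_cure_fin5`); ★★ `chartC_clause`, `chartE_clause`: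
  the vertex charts `blowupAlgebra 𝓚_M x̄2`, `blowupAlgebra 𝓚_M x̄4` satisfy the CM + Frobenius-closed clause at EVERY maximal ideal (`char k = 2`; thin cells of
  `…LoopGermMCharts`). Together: idea-1's 2-round policy «`V(a,c,e)`, then `V(c,d,e)` on chart `a`» for `M`, first round, kernel side.
[folklore mathematics, OURS as a certificate; cite: Fedder1983, Thm. 1.12; StacksProject, Tag 0804 and Tag 080E; Kollar2007, §2.5]
-/

-- single-problem summit: the doubled namespace component is forced
set_option linter.dupNamespace false

noncomputable section

open AlgebraicGeometry CategoryTheory Literature.AlgebraicGeometry.Resolution TopologicalSpace IsLocalRing MvPolynomial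

namespace Summit.ResolutionOfSingularities.ResolutionOfSingularities.Theorems.FInjectiveMacaulayfication.LoopGermMCure

open Summit.ResolutionOfSingularities.ResolutionOfSingularities.Theorems.FInjectiveMacaulayfication
open SliceableCentre

/-! ## §1 Generic coefficient domain `A ∋ b, d`: the charts of `Bl_{(a,c,e)} Spec A[a,c,e]/(M)` -/

section Generic

variable (A : Type) [CommRing A] (b d : A)

/-- The three substitutions `θ_j` of `A[a,c,e]` carry `M` to `Y_j² · M_j`; `M_a` is `L` written in `(a, c′, e′)` with coefficients `b, d`. [certificate; cite: Kollar2007, §2.5] -/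
theorem theta (F : MvPolynomial (Fin 3) A) (hF : F = X 2 ^ 2 + X 0 ^ 2 * X 1 * X 2 + X 0 * X 1 ^ 2 + C (d ^ 2) * X 0 ^ 2 * X 1 + C (b ^ 3) * X 0 * X 1 ^ 2)
    (G : Fin 3 → MvPolynomial (Fin 3) A) (hG : G = ![X 2 ^ 2 + X 0 ^ 2 * X 1 * X 2 + X 0 * X 1 ^ 2 + C (d ^ 2) * X 0 * X 1 + C (b ^ 3) * X 0 * X 1 ^ 2,
      X 2 ^ 2 + X 0 ^ 2 * X 1 ^ 2 * X 2 + X 0 * X 1 + C (d ^ 2) * X 0 ^ 2 * X 1 + C (b ^ 3) * X 0 * X 1,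
      1 + X 0 ^ 2 * X 1 * X 2 ^ 2 + X 0 * X 1 ^ 2 * X 2 + C (d ^ 2) * X 0 ^ 2 * X 1 * X 2 + C (b ^ 3) * X 0 * X 1 ^ 2 * X 2]) (j : Fin 3) :
    (aeval fun l : Fin 3 => if l = j then (X j : MvPolynomial (Fin 3) A) else X l * X j) F = X j ^ 2 * G j := by
  subst hF; subst hG
  fin_cases j <;> simp <;> ring

variable [IsDomain A]

/-- The strict transforms are PRIME in `A[a,c,e]` (`A` a domain), by `PrimeTransfer.prime_transform_of_prime`. [folklore] -/
theorem prime_G (F : MvPolynomial (Fin 3) A) (hF : F = X 2 ^ 2 + X 0 ^ 2 * X 1 * X 2 + X 0 * X 1 ^ 2 + C (d ^ 2) * X 0 ^ 2 * X 1 + C (b ^ 3) * X 0 * X 1 ^ 2)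
    (G : Fin 3 → MvPolynomial (Fin 3) A) (hG : G = ![X 2 ^ 2 + X 0 ^ 2 * X 1 * X 2 + X 0 * X 1 ^ 2 + C (d ^ 2) * X 0 * X 1 + C (b ^ 3) * X 0 * X 1 ^ 2,
      X 2 ^ 2 + X 0 ^ 2 * X 1 ^ 2 * X 2 + X 0 * X 1 + C (d ^ 2) * X 0 ^ 2 * X 1 + C (b ^ 3) * X 0 * X 1,
      1 + X 0 ^ 2 * X 1 * X 2 ^ 2 + X 0 * X 1 ^ 2 * X 2 + C (d ^ 2) * X 0 ^ 2 * X 1 * X 2 + C (b ^ 3) * X 0 * X 1 ^ 2 * X 2]) (hFp : Prime F)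
    (hnm : ∀ j : Fin 3, F ∉ Ideal.span {(X j : MvPolynomial (Fin 3) A)} ∧ G j ∉ Ideal.span {(X j : MvPolynomial (Fin 3) A)}) (j : Fin 3) : Prime (G j) := by
  refine PrimeTransfer.prime_transform_of_prime ((aeval fun l : Fin 3 => if l = j then (X j : MvPolynomial (Fin 3) A) else X l * X j).toRingHom)
    (fun c => ?_) ?_ (fun l hl => ?_) (theta A b d F hF G hG j) (hnm j).1 (hnm j).2 hFp
  · show aeval _ (C c) = C c
    rw [aeval_C]; rfl
  · show aeval _ (X j) = X j
    rw [aeval_X, if_pos rfl]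
  · show aeval _ (X l) = X l * X j
    rw [aeval_X, if_neg hl]

set_option maxHeartbeats 800000 in
-- one strict-transform identification, one Rees-chart identification, one blow-up-algebra transport
/-- ★ **The vertex chart, in ANY presentation `R₅ ≅ A[a,c,e]/(M)` of the base** (`Ψ` the presentation isomorphism, `I₅ = Ψ(𝓚_M)`, `x₅ = Ψ(ȳ_j)`):
`blowupAlgebra I₅ x₅ ≃ A[a,c,e]/(M_j)` with `x₅/1 ↦ ȳ_j` (`StrictTransformChartN.exists_ringEquiv` ∘ `ReesChartFacts.exists_reesChartEquiv` ∘
`PointFixableTransport.exists_blowupAlgebra_congr'`). [folklore glue] -/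
theorem exists_chart_equiv (F : MvPolynomial (Fin 3) A) (hF : F = X 2 ^ 2 + X 0 ^ 2 * X 1 * X 2 + X 0 * X 1 ^ 2 + C (d ^ 2) * X 0 ^ 2 * X 1 + C (b ^ 3) * X 0 * X 1 ^ 2)
    (G : Fin 3 → MvPolynomial (Fin 3) A) (hG : G = ![X 2 ^ 2 + X 0 ^ 2 * X 1 * X 2 + X 0 * X 1 ^ 2 + C (d ^ 2) * X 0 * X 1 + C (b ^ 3) * X 0 * X 1 ^ 2,
      X 2 ^ 2 + X 0 ^ 2 * X 1 ^ 2 * X 2 + X 0 * X 1 + C (d ^ 2) * X 0 ^ 2 * X 1 + C (b ^ 3) * X 0 * X 1,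
      1 + X 0 ^ 2 * X 1 * X 2 ^ 2 + X 0 * X 1 ^ 2 * X 2 + C (d ^ 2) * X 0 ^ 2 * X 1 * X 2 + C (b ^ 3) * X 0 * X 1 ^ 2 * X 2]) (hFp : Prime F)
    (hnm : ∀ j : Fin 3, F ∉ Ideal.span {(X j : MvPolynomial (Fin 3) A)} ∧ G j ∉ Ideal.span {(X j : MvPolynomial (Fin 3) A)}) (j : Fin 3)
    (R₅ : Type) [CommRing R₅] (Ψ : (MvPolynomial (Fin 3) A ⧸ Ideal.span {F}) ≃+* R₅) (I₅ : Ideal R₅) (x₅ : R₅)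
    (hI : I₅ = Ideal.map (Ψ : (MvPolynomial (Fin 3) A ⧸ Ideal.span {F}) →+* R₅) (Ideal.span (Set.range fun l : Fin 3 => Ideal.Quotient.mk (Ideal.span {F}) (X l))))
    (hx : x₅ = Ψ (Ideal.Quotient.mk (Ideal.span {F}) (X j))) :
    ∃ e : blowupAlgebra I₅ x₅ ≃+* (MvPolynomial (Fin 3) A ⧸ Ideal.span {G j}),
      e (algebraMap _ _ x₅) = Ideal.Quotient.mk (Ideal.span {G j}) (X j) := by
  classical
  have hGp := prime_G A b d F hF G hG hFp hnm j
  have hGprime : (Ideal.span {G j}).IsPrime := (Ideal.span_singleton_prime hGp.ne_zero).mpr hGp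
  have hxj : Ideal.Quotient.mk (Ideal.span {F}) (X j) ∈ Ideal.span (Set.range fun l : Fin 3 => Ideal.Quotient.mk (Ideal.span {F}) (X l)) := Ideal.subset_span ⟨j, rfl⟩
  obtain ⟨e₀, he₀⟩ := StrictTransformChartN.exists_ringEquiv (Ideal.Quotient.mk (Ideal.span {F})) Ideal.Quotient.mk_surjective
    (fun l : Fin 3 => Ideal.Quotient.mk (Ideal.span {F}) (X l)) (i := j) (fun _ => rfl) (fun s => Ideal.Quotient.eq_zero_iff_mem) hGprime
    (PrimeTransfer.X_not_mem_span_of_isPrime hGprime (hnm j).2)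
    ((aeval fun l : Fin 3 => if l = j then (X j : MvPolynomial (Fin 3) A) else X l * X j).toRingHom)
    (fun c => by show aeval _ (C c) = C c; rw [aeval_C]; rfl) (by show aeval _ (X j) = X j; rw [aeval_X, if_pos rfl])
    (fun l hl => by show aeval _ (X l) = X l * X j; rw [aeval_X, if_neg hl]) (theta A b d F hF G hG j)
  obtain ⟨e₁, he₁⟩ := ReesChartFacts.exists_reesChartEquiv (Ideal.span (Set.range fun l : Fin 3 => Ideal.Quotient.mk (Ideal.span {F}) (X l))) _ hxj
  obtain ⟨E, hE⟩ := PointFixableTransport.exists_blowupAlgebra_congr' Ψ (Ideal.span (Set.range fun l : Fin 3 => Ideal.Quotient.mk (Ideal.span {F}) (X l))) (Ideal.Quotient.mk (Ideal.span {F}) (X j))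
    I₅ x₅ hI hx
  refine ⟨E.symm.trans (e₀.trans e₁).symm, ?_⟩
  have hE0 : E.symm (algebraMap _ _ x₅) = algebraMap _ _ (Ideal.Quotient.mk (Ideal.span {F}) (X j)) := by
    rw [RingEquiv.symm_apply_eq, hE, ← hx]
  rw [RingEquiv.trans_apply, hE0, RingEquiv.symm_apply_eq, RingEquiv.trans_apply, he₀, he₁]

set_option maxHeartbeats 800000 in
-- one clause transport along `exists_chart_equiv`
/-- ★ **The clause on the vertex chart `blowupAlgebra I₅ x₅`** (any presentation) from a clause at every maximal ideal of `A[a,c,e]/(M_j)`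
(`E8Char5FiModel.clause_maximal_of_ringEquiv`). [folklore glue; cite: Fedder1983, Thm. 1.12] -/
theorem hon_chart (F : MvPolynomial (Fin 3) A) (hF : F = X 2 ^ 2 + X 0 ^ 2 * X 1 * X 2 + X 0 * X 1 ^ 2 + C (d ^ 2) * X 0 ^ 2 * X 1 + C (b ^ 3) * X 0 * X 1 ^ 2)
    (G : Fin 3 → MvPolynomial (Fin 3) A) (hG : G = ![X 2 ^ 2 + X 0 ^ 2 * X 1 * X 2 + X 0 * X 1 ^ 2 + C (d ^ 2) * X 0 * X 1 + C (b ^ 3) * X 0 * X 1 ^ 2,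
      X 2 ^ 2 + X 0 ^ 2 * X 1 ^ 2 * X 2 + X 0 * X 1 + C (d ^ 2) * X 0 ^ 2 * X 1 + C (b ^ 3) * X 0 * X 1,
      1 + X 0 ^ 2 * X 1 * X 2 ^ 2 + X 0 * X 1 ^ 2 * X 2 + C (d ^ 2) * X 0 ^ 2 * X 1 * X 2 + C (b ^ 3) * X 0 * X 1 ^ 2 * X 2]) (hFp : Prime F)
    (hnm : ∀ j : Fin 3, F ∉ Ideal.span {(X j : MvPolynomial (Fin 3) A)} ∧ G j ∉ Ideal.span {(X j : MvPolynomial (Fin 3) A)}) (j : Fin 3)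
    (hcl : ∀ (Q' : Ideal (MvPolynomial (Fin 3) A ⧸ Ideal.span {G j})) [Q'.IsMaximal],
      ∀ n₀ : ℕ, ringKrullDim (Localization.AtPrime Q') = n₀ → ∀ s : Fin n₀ → Localization.AtPrime Q',
      (Ideal.span (Set.range s)).radical.IsMaximal →
        RingTheory.Sequence.IsWeaklyRegular (Localization.AtPrime Q') (List.ofFn s) ∧
        ∀ y : Localization.AtPrime Q', (∃ n : ℕ, y ^ 2 ^ n ∈ Ideal.span
          ((fun z : Localization.AtPrime Q' => z ^ 2 ^ n) '' (Ideal.span (Set.range s) : Set (Localization.AtPrime Q')))) → y ∈ Ideal.span (Set.range s))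
    (R₅ : Type) [CommRing R₅] (Ψ : (MvPolynomial (Fin 3) A ⧸ Ideal.span {F}) ≃+* R₅) (I₅ : Ideal R₅) (x₅ : R₅)
    (hI : I₅ = Ideal.map (Ψ : (MvPolynomial (Fin 3) A ⧸ Ideal.span {F}) →+* R₅) (Ideal.span (Set.range fun l : Fin 3 => Ideal.Quotient.mk (Ideal.span {F}) (X l))))
    (hx : x₅ = Ψ (Ideal.Quotient.mk (Ideal.span {F}) (X j)))
    (Q : Ideal (blowupAlgebra I₅ x₅)) [Q.IsMaximal] :
    ∀ n₀ : ℕ, ringKrullDim (Localization.AtPrime Q) = n₀ → ∀ s : Fin n₀ → Localization.AtPrime Q,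
      (Ideal.span (Set.range s)).radical.IsMaximal →
        RingTheory.Sequence.IsWeaklyRegular (Localization.AtPrime Q) (List.ofFn s) ∧
        ∀ y : Localization.AtPrime Q, (∃ n : ℕ, y ^ 2 ^ n ∈ Ideal.span
          ((fun z : Localization.AtPrime Q => z ^ 2 ^ n) '' (Ideal.span (Set.range s) : Set (Localization.AtPrime Q)))) → y ∈ Ideal.span (Set.range s) := by
  obtain ⟨e, -⟩ := exists_chart_equiv A b d F hF G hG hFp hnm j R₅ Ψ I₅ x₅ hI hx
  exact E8Char5FiModel.clause_maximal_of_ringEquiv 2 e.symm 0 0 (map_zero _) (fun Q' _ _ => hcl Q') Q (Ideal.zero_mem Q)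

end Generic

/-! ## §2 `A = k₀ = k[b,d]` (`b = X0`, `d = X1` of `k₀`; outer `a, c, e = X0, X1, X2`) -/

section LoopGerm

variable (k : Type) [Field k]

/-- ★ The flattening isomorphism `Φ : k₀[a,c,e] ≃ k[a,b,c,d,e]`: outer `X0,X1,X2 ↦ X0,X2,X4`, coefficients `C(X0), C(X1) ↦ X1, X3`. [plumbing] -/
theorem exists_flatten : ∃ Φ : MvPolynomial (Fin 3) (MvPolynomial (Fin 2) k) ≃+* MvPolynomial (Fin 5) k,
    Φ (X 0) = X 0 ∧ Φ (X 1) = X 2 ∧ Φ (X 2) = X 4 ∧ Φ (C (X 0)) = X 1 ∧ Φ (C (X 1)) = X 3 ∧ ∀ a : k, Φ (C (C a)) = C a := by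
  let σ : Fin 3 ⊕ Fin 2 ≃ Fin 5 :=
    ⟨fun x => Sum.elim ![(0 : Fin 5), 2, 4] ![(1 : Fin 5), 3] x, ![Sum.inl 0, Sum.inr 0, Sum.inl 1, Sum.inr 1, Sum.inl 2], by decide, by decide⟩
  refine ⟨(sumRingEquiv k (Fin 3) (Fin 2)).symm.trans (renameEquiv k σ).toRingEquiv, ?_, ?_, ?_, ?_, ?_, ?_⟩
  · rw [RingEquiv.trans_apply, sumRingEquiv_symm_X]
    show rename _ (X (Sum.inl 0)) = X 0
    rw [rename_X]; rfl
  · rw [RingEquiv.trans_apply, sumRingEquiv_symm_X]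
    show rename _ (X (Sum.inl 1)) = X 2
    rw [rename_X]; rfl
  · rw [RingEquiv.trans_apply, sumRingEquiv_symm_X]
    show rename _ (X (Sum.inl 2)) = X 4
    rw [rename_X]; rfl
  · rw [RingEquiv.trans_apply, sumRingEquiv_symm_C_X]
    show rename _ (X (Sum.inr 0)) = X 1
    rw [rename_X]; rfl
  · rw [RingEquiv.trans_apply, sumRingEquiv_symm_C_X]
    show rename _ (X (Sum.inr 1)) = X 3
    rw [rename_X]; rfl
  · intro a
    rw [RingEquiv.trans_apply, sumRingEquiv_symm_C_C]
    show rename _ (C a) = C a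
    rw [rename_C]

/-- `Φ` carries `M, M_a, M_c, M_e` (presentation `k₀[a,c,e]`) to `M`, **`L`**, `M_c`, `M_e` of `…LoopGermMCharts` / `…LoopGermLCharts`. [certificate] -/
theorem flatten_values (Φ : MvPolynomial (Fin 3) (MvPolynomial (Fin 2) k) ≃+* MvPolynomial (Fin 5) k)
    (h0 : Φ (X 0) = X 0) (h1 : Φ (X 1) = X 2) (h2 : Φ (X 2) = X 4) (hb : Φ (C (X 0)) = X 1) (hd : Φ (C (X 1)) = X 3) :
    Φ (X 2 ^ 2 + X 0 ^ 2 * X 1 * X 2 + X 0 * X 1 ^ 2 + C (X 1 ^ 2) * X 0 ^ 2 * X 1 + C (X 0 ^ 3) * X 0 * X 1 ^ 2) = X 4 ^ 2 + X 0 ^ 2 * X 2 * X 4 + X 0 * X 2 ^ 2 + X 0 ^ 2 * X 2 * X 3 ^ 2 + X 0 * X 1 ^ 3 * X 2 ^ 2 ∧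
    Φ (X 2 ^ 2 + X 0 ^ 2 * X 1 * X 2 + X 0 * X 1 ^ 2 + C (X 1 ^ 2) * X 0 * X 1 + C (X 0 ^ 3) * X 0 * X 1 ^ 2) = X 4 ^ 2 + X 0 ^ 2 * X 2 * X 4 + X 0 * X 2 ^ 2 + X 0 * X 2 * X 3 ^ 2 + X 0 * X 1 ^ 3 * X 2 ^ 2 ∧
    Φ (X 2 ^ 2 + X 0 ^ 2 * X 1 ^ 2 * X 2 + X 0 * X 1 + C (X 1 ^ 2) * X 0 ^ 2 * X 1 + C (X 0 ^ 3) * X 0 * X 1) = X 4 ^ 2 + X 0 ^ 2 * X 2 ^ 2 * X 4 + X 0 * X 2 + X 0 ^ 2 * X 2 * X 3 ^ 2 + X 0 * X 1 ^ 3 * X 2 ∧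
    Φ (1 + X 0 ^ 2 * X 1 * X 2 ^ 2 + X 0 * X 1 ^ 2 * X 2 + C (X 1 ^ 2) * X 0 ^ 2 * X 1 * X 2 + C (X 0 ^ 3) * X 0 * X 1 ^ 2 * X 2) = 1 + X 0 ^ 2 * X 2 * X 4 ^ 2 + X 0 * X 2 ^ 2 * X 4 + X 0 ^ 2 * X 2 * X 3 ^ 2 * X 4 + X 0 * X 1 ^ 3 * X 2 ^ 2 * X 4 := by
  refine ⟨?_, ?_, ?_, ?_⟩ <;> (simp only [map_add, map_mul, map_pow, map_one, h0, h1, h2, hb, hd]; ring)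

/-- ★ **The two presentations of `U_M` agree**: `k₀[a,c,e]/(M) ≃ k[a,…,e]/(M)` with `ā, c̄, ē ↦ x̄0, x̄2, x̄4` and `b̄, d̄ ↦ x̄1, x̄3`. [plumbing] -/
theorem exists_presentationEquiv (F : MvPolynomial (Fin 3) (MvPolynomial (Fin 2) k)) (hF : F = X 2 ^ 2 + X 0 ^ 2 * X 1 * X 2 + X 0 * X 1 ^ 2 + C (X 1 ^ 2) * X 0 ^ 2 * X 1 + C (X 0 ^ 3) * X 0 * X 1 ^ 2) (g : MvPolynomial (Fin 5) k) (hg : g = X 4 ^ 2 + X 0 ^ 2 * X 2 * X 4 + X 0 * X 2 ^ 2 + X 0 ^ 2 * X 2 * X 3 ^ 2 + X 0 * X 1 ^ 3 * X 2 ^ 2) :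
    ∃ Ψ : (MvPolynomial (Fin 3) (MvPolynomial (Fin 2) k) ⧸ Ideal.span {F}) ≃+* (MvPolynomial (Fin 5) k ⧸ Ideal.span {g}),
      Ψ (Ideal.Quotient.mk _ (X 0)) = Ideal.Quotient.mk _ (X 0) ∧ Ψ (Ideal.Quotient.mk _ (X 1)) = Ideal.Quotient.mk _ (X 2) ∧
      Ψ (Ideal.Quotient.mk _ (X 2)) = Ideal.Quotient.mk _ (X 4) ∧ Ψ (Ideal.Quotient.mk _ (C (X 0))) = Ideal.Quotient.mk _ (X 1) ∧
      Ψ (Ideal.Quotient.mk _ (C (X 1))) = Ideal.Quotient.mk _ (X 3) := by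
  obtain ⟨Φ, h0, h1, h2, hb, hd, -⟩ := exists_flatten k
  have hΦF : Φ F = g := by rw [hF, hg]; exact (flatten_values k Φ h0 h1 h2 hb hd).1
  have hIJ : Ideal.span {g} = Ideal.map (Φ : MvPolynomial (Fin 3) (MvPolynomial (Fin 2) k) →+* MvPolynomial (Fin 5) k) (Ideal.span {F}) := by
    rw [Ideal.map_span, Set.image_singleton]; simp [hΦF]
  refine ⟨Ideal.quotientEquiv _ _ Φ hIJ, ?_, ?_, ?_, ?_, ?_⟩ <;> simp [h0, h1, h2, hb, hd]

/-- ★ `M` is PRIME in `k₀[a,c,e]` (from `LoopGermMCharts.prime_M` through `Φ`). [folklore] -/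
theorem prime_F (F : MvPolynomial (Fin 3) (MvPolynomial (Fin 2) k)) (hF : F = X 2 ^ 2 + X 0 ^ 2 * X 1 * X 2 + X 0 * X 1 ^ 2 + C (X 1 ^ 2) * X 0 ^ 2 * X 1 + C (X 0 ^ 3) * X 0 * X 1 ^ 2) : Prime F := by
  obtain ⟨Φ, h0, h1, h2, hb, hd, -⟩ := exists_flatten k
  have hΦF : Φ F = X 4 ^ 2 + X 0 ^ 2 * X 2 * X 4 + X 0 * X 2 ^ 2 + X 0 ^ 2 * X 2 * X 3 ^ 2 + X 0 * X 1 ^ 3 * X 2 ^ 2 := by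
    rw [hF]; exact (flatten_values k Φ h0 h1 h2 hb hd).1
  have h := LoopGermMCharts.prime_M k _ rfl
  rw [← hΦF] at h
  exact (MulEquiv.prime_iff Φ).mp h

/-- `M ∉ (Y_j)` and `M_j ∉ (Y_j)` in `k₀[a,c,e]` (a `k`-point with `Y_j = 0` at which the polynomial is `1`). [certificate] -/
theorem not_mem_span_X (F : MvPolynomial (Fin 3) (MvPolynomial (Fin 2) k)) (hF : F = X 2 ^ 2 + X 0 ^ 2 * X 1 * X 2 + X 0 * X 1 ^ 2 + C (X 1 ^ 2) * X 0 ^ 2 * X 1 + C (X 0 ^ 3) * X 0 * X 1 ^ 2)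
    (G : Fin 3 → MvPolynomial (Fin 3) (MvPolynomial (Fin 2) k)) (hG : G = ![X 2 ^ 2 + X 0 ^ 2 * X 1 * X 2 + X 0 * X 1 ^ 2 + C (X 1 ^ 2) * X 0 * X 1 + C (X 0 ^ 3) * X 0 * X 1 ^ 2,
      X 2 ^ 2 + X 0 ^ 2 * X 1 ^ 2 * X 2 + X 0 * X 1 + C (X 1 ^ 2) * X 0 ^ 2 * X 1 + C (X 0 ^ 3) * X 0 * X 1,
      1 + X 0 ^ 2 * X 1 * X 2 ^ 2 + X 0 * X 1 ^ 2 * X 2 + C (X 1 ^ 2) * X 0 ^ 2 * X 1 * X 2 + C (X 0 ^ 3) * X 0 * X 1 ^ 2 * X 2]) (j : Fin 3) :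
    F ∉ Ideal.span {(X j : MvPolynomial (Fin 3) (MvPolynomial (Fin 2) k))} ∧ G j ∉ Ideal.span {(X j : MvPolynomial (Fin 3) (MvPolynomial (Fin 2) k))} := by
  subst hF; subst hG
  -- evaluation `k₀[a,c,e] → k`: inner point `(b,d) = (0,0)`, outer point killing `Y_j`
  have key : ∀ (q : MvPolynomial (Fin 3) (MvPolynomial (Fin 2) k)) (pt : Fin 3 → k), pt j = 0 →
      MvPolynomial.eval₂Hom (MvPolynomial.eval ![(0 : k), 0]) pt q ≠ 0 → q ∉ Ideal.span {(X j : MvPolynomial (Fin 3) (MvPolynomial (Fin 2) k))} := by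
    intro q pt hpt hq h
    rw [Ideal.mem_span_singleton] at h
    obtain ⟨r, hr⟩ := h
    apply hq
    rw [hr, map_mul]
    simp [hpt]
  fin_cases j
  · exact ⟨key _ ![0, 0, 1] rfl (by simp), key _ ![0, 0, 1] rfl (by simp)⟩
  · exact ⟨key _ ![0, 0, 1] rfl (by simp), key _ ![0, 0, 1] rfl (by simp)⟩
  · exact ⟨key _ ![1, 1, 0] rfl (by simp), key _ ![0, 0, 0] rfl (by simp)⟩

/-! ## §3 ★★★ The `k[X]`-presentation: the `a`-chart is `U_L`; the charts `c`, `e` are cured -/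

/-- `Ψ` carries the centre `(ā, c̄, ē) ⊂ k₀[a,c,e]/(M)` onto `(x̄0, x̄2, x̄4) ⊂ k[X]/(M)`. [plumbing] -/
theorem map_centre (F : MvPolynomial (Fin 3) (MvPolynomial (Fin 2) k)) (g : MvPolynomial (Fin 5) k)
    (Ψ : (MvPolynomial (Fin 3) (MvPolynomial (Fin 2) k) ⧸ Ideal.span {F}) ≃+* (MvPolynomial (Fin 5) k ⧸ Ideal.span {g}))
    (hΨ0 : Ψ (Ideal.Quotient.mk _ (X 0)) = Ideal.Quotient.mk _ (X 0)) (hΨ1 : Ψ (Ideal.Quotient.mk _ (X 1)) = Ideal.Quotient.mk _ (X 2))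
    (hΨ2 : Ψ (Ideal.Quotient.mk _ (X 2)) = Ideal.Quotient.mk _ (X 4)) :
    Ideal.span ({Ideal.Quotient.mk (Ideal.span {g}) (X 0), Ideal.Quotient.mk (Ideal.span {g}) (X 2), Ideal.Quotient.mk (Ideal.span {g}) (X 4)} : Set (MvPolynomial (Fin 5) k ⧸ Ideal.span {g})) = Ideal.map (Ψ : (MvPolynomial (Fin 3) (MvPolynomial (Fin 2) k) ⧸ Ideal.span {F}) →+* (MvPolynomial (Fin 5) k ⧸ Ideal.span {g})) (Ideal.span (Set.range fun l : Fin 3 => Ideal.Quotient.mk (Ideal.span {F}) (X l))) := by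
  rw [Ideal.map_span]
  apply le_antisymm
  · rw [Ideal.span_le]
    intro x hx
    simp only [Set.mem_insert_iff, Set.mem_singleton_iff] at hx
    rcases hx with rfl | rfl | rfl
    · exact Ideal.subset_span ⟨_, ⟨0, rfl⟩, hΨ0⟩
    · exact Ideal.subset_span ⟨_, ⟨1, rfl⟩, hΨ1⟩
    · exact Ideal.subset_span ⟨_, ⟨2, rfl⟩, hΨ2⟩
  · rw [Ideal.span_le]
    rintro _ ⟨_, ⟨l, rfl⟩, rfl⟩
    fin_cases l
    · exact Ideal.subset_span (by simp [hΨ0])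
    · exact Ideal.subset_span (by simp [hΨ1])
    · exact Ideal.subset_span (by simp [hΨ2])

set_option maxHeartbeats 1600000 in
-- §1 instantiated + one flattening
/-- ★★★ **THE `a`-CHART OF `Bl_{(a,c,e)} U_M` IS `U_L`** (`k[X]`-presentations on both sides): `blowupAlgebra (x̄0, x̄2, x̄4) x̄0 ≃ k[X]/(L)`,
`L = X4² + X0²X2X4 + X0X2² + X0X2X3² + X0X1³X2²` = `…LoopGermLCharts`' loop germ — the arrow `M → L` of the rad-τ loop in the kernel (any field), `x̄0/1 ↦ x̄0`.
Combined with `…LoopGermLCureFin5.loopGerm_cure_fin5` (one plane blow-up cures `U_L`) this is idea-1's 2-round policy for `M`, chart `a`.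
[OURS; cite: StacksProject, Tag 0804; Kollar2007, §2.5] -/
theorem exists_chartA_equiv (g : MvPolynomial (Fin 5) k) (hg : g = X 4 ^ 2 + X 0 ^ 2 * X 2 * X 4 + X 0 * X 2 ^ 2 + X 0 ^ 2 * X 2 * X 3 ^ 2 + X 0 * X 1 ^ 3 * X 2 ^ 2) (f : MvPolynomial (Fin 5) k) (hf : f = X 4 ^ 2 + X 0 ^ 2 * X 2 * X 4 + X 0 * X 2 ^ 2 + X 0 * X 2 * X 3 ^ 2 + X 0 * X 1 ^ 3 * X 2 ^ 2) :
    ∃ e : blowupAlgebra (Ideal.span ({Ideal.Quotient.mk (Ideal.span {g}) (X 0), Ideal.Quotient.mk (Ideal.span {g}) (X 2), Ideal.Quotient.mk (Ideal.span {g}) (X 4)} : Set (MvPolynomial (Fin 5) k ⧸ Ideal.span {g}))) (Ideal.Quotient.mk (Ideal.span {g}) (X 0)) ≃+* (MvPolynomial (Fin 5) k ⧸ Ideal.span {f}),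
      e (algebraMap _ _ (Ideal.Quotient.mk (Ideal.span {g}) (X 0))) = Ideal.Quotient.mk (Ideal.span {f}) (X 0) := by
  classical
  obtain ⟨Φ, h0, h1, h2, hb, hd, -⟩ := exists_flatten k
  have hv := flatten_values k Φ h0 h1 h2 hb hd
  obtain ⟨Ψ, hΨ0, hΨ1, hΨ2, -, -⟩ := exists_presentationEquiv k _ rfl g hg
  obtain ⟨eA, heA⟩ := exists_chart_equiv (MvPolynomial (Fin 2) k) (X 0) (X 1) _ rfl _ rfl (prime_F k _ rfl) (not_mem_span_X k _ rfl _ rfl) 0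
    (MvPolynomial (Fin 5) k ⧸ Ideal.span {g}) Ψ _ _ (map_centre k _ g Ψ hΨ0 hΨ1 hΨ2) hΨ0.symm
  -- the flattening `k₀[a,c,e]/(M_a) ≃ k[X]/(L)`
  have hGa : Φ (X 2 ^ 2 + X 0 ^ 2 * X 1 * X 2 + X 0 * X 1 ^ 2 + C (X 1 ^ 2) * X 0 * X 1 + C (X 0 ^ 3) * X 0 * X 1 ^ 2) = f := by rw [hf]; exact hv.2.1
  have hIJ : Ideal.span {f} = Ideal.map (Φ : MvPolynomial (Fin 3) (MvPolynomial (Fin 2) k) →+* MvPolynomial (Fin 5) k) (Ideal.span {(X 2 ^ 2 + X 0 ^ 2 * X 1 * X 2 + X 0 * X 1 ^ 2 + C (X 1 ^ 2) * X 0 * X 1 + C (X 0 ^ 3) * X 0 * X 1 ^ 2 : MvPolynomial (Fin 3) (MvPolynomial (Fin 2) k))}) := by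
    rw [Ideal.map_span, Set.image_singleton, RingHom.coe_coe, hGa]
  -- retype the chart equivalence on the literal strict transform (definitional unfolding of `![…] 0`)
  let eA' : blowupAlgebra (Ideal.span ({Ideal.Quotient.mk (Ideal.span {g}) (X 0), Ideal.Quotient.mk (Ideal.span {g}) (X 2), Ideal.Quotient.mk (Ideal.span {g}) (X 4)} : Set (MvPolynomial (Fin 5) k ⧸ Ideal.span {g}))) (Ideal.Quotient.mk (Ideal.span {g}) (X 0)) ≃+* (MvPolynomial (Fin 3) (MvPolynomial (Fin 2) k) ⧸ Ideal.span {(X 2 ^ 2 + X 0 ^ 2 * X 1 * X 2 + X 0 * X 1 ^ 2 + C (X 1 ^ 2) * X 0 * X 1 + C (X 0 ^ 3) * X 0 * X 1 ^ 2 : MvPolynomial (Fin 3) (MvPolynomial (Fin 2) k))}) := eA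
  have heA' : eA' (algebraMap _ _ (Ideal.Quotient.mk (Ideal.span {g}) (X 0))) = Ideal.Quotient.mk (Ideal.span {(X 2 ^ 2 + X 0 ^ 2 * X 1 * X 2 + X 0 * X 1 ^ 2 + C (X 1 ^ 2) * X 0 * X 1 + C (X 0 ^ 3) * X 0 * X 1 ^ 2 : MvPolynomial (Fin 3) (MvPolynomial (Fin 2) k))}) (X 0) := heA
  refine ⟨eA'.trans (Ideal.quotientEquiv (Ideal.span {(X 2 ^ 2 + X 0 ^ 2 * X 1 * X 2 + X 0 * X 1 ^ 2 + C (X 1 ^ 2) * X 0 * X 1 + C (X 0 ^ 3) * X 0 * X 1 ^ 2 : MvPolynomial (Fin 3) (MvPolynomial (Fin 2) k))}) (Ideal.span {f}) Φ hIJ), ?_⟩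
  rw [RingEquiv.trans_apply, heA', Ideal.quotientEquiv_mk, h0]

set_option maxHeartbeats 1600000 in
-- §1 instantiated + one clause transport along the flattening
/-- ★★ **CHART `c` OF `Bl_{(a,c,e)} U_M` IS CURED** (`char k = 2`): every maximal ideal of `blowupAlgebra (x̄0, x̄2, x̄4) x̄2` satisfies the CM + Frobenius-closed
clause (`…LoopGermMCharts.clause_chart_c` through `Φ`, §1 `hon_chart` in the `k[X]`-presentation). [OURS; cite: Fedder1983, Thm. 1.12] -/
theorem chartC_clause [CharP k 2] (g : MvPolynomial (Fin 5) k) (hg : g = X 4 ^ 2 + X 0 ^ 2 * X 2 * X 4 + X 0 * X 2 ^ 2 + X 0 ^ 2 * X 2 * X 3 ^ 2 + X 0 * X 1 ^ 3 * X 2 ^ 2)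
    (Q : Ideal (blowupAlgebra (Ideal.span ({Ideal.Quotient.mk (Ideal.span {g}) (X 0), Ideal.Quotient.mk (Ideal.span {g}) (X 2), Ideal.Quotient.mk (Ideal.span {g}) (X 4)} : Set (MvPolynomial (Fin 5) k ⧸ Ideal.span {g}))) (Ideal.Quotient.mk (Ideal.span {g}) (X 2)))) [Q.IsMaximal] :
    ∀ n₀ : ℕ, ringKrullDim (Localization.AtPrime Q) = n₀ → ∀ s : Fin n₀ → Localization.AtPrime Q,
      (Ideal.span (Set.range s)).radical.IsMaximal →
        RingTheory.Sequence.IsWeaklyRegular (Localization.AtPrime Q) (List.ofFn s) ∧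
        ∀ y : Localization.AtPrime Q, (∃ n : ℕ, y ^ 2 ^ n ∈ Ideal.span
          ((fun z : Localization.AtPrime Q => z ^ 2 ^ n) '' (Ideal.span (Set.range s) : Set (Localization.AtPrime Q)))) → y ∈ Ideal.span (Set.range s) := by
  classical
  obtain ⟨Φ, h0, h1, h2, hb, hd, -⟩ := exists_flatten k
  have hv := flatten_values k Φ h0 h1 h2 hb hd
  obtain ⟨Ψ, hΨ0, hΨ1, hΨ2, -, -⟩ := exists_presentationEquiv k _ rfl g hg
  have hGj : Φ ((![X 2 ^ 2 + X 0 ^ 2 * X 1 * X 2 + X 0 * X 1 ^ 2 + C (X 1 ^ 2) * X 0 * X 1 + C (X 0 ^ 3) * X 0 * X 1 ^ 2,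
        X 2 ^ 2 + X 0 ^ 2 * X 1 ^ 2 * X 2 + X 0 * X 1 + C (X 1 ^ 2) * X 0 ^ 2 * X 1 + C (X 0 ^ 3) * X 0 * X 1,
        1 + X 0 ^ 2 * X 1 * X 2 ^ 2 + X 0 * X 1 ^ 2 * X 2 + C (X 1 ^ 2) * X 0 ^ 2 * X 1 * X 2 + C (X 0 ^ 3) * X 0 * X 1 ^ 2 * X 2] : Fin 3 → MvPolynomial (Fin 3) (MvPolynomial (Fin 2) k)) 1) = X 4 ^ 2 + X 0 ^ 2 * X 2 ^ 2 * X 4 + X 0 * X 2 + X 0 ^ 2 * X 2 * X 3 ^ 2 + X 0 * X 1 ^ 3 * X 2 := hv.2.2.1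
  have hIJ : Ideal.span {(![X 2 ^ 2 + X 0 ^ 2 * X 1 * X 2 + X 0 * X 1 ^ 2 + C (X 1 ^ 2) * X 0 * X 1 + C (X 0 ^ 3) * X 0 * X 1 ^ 2,
        X 2 ^ 2 + X 0 ^ 2 * X 1 ^ 2 * X 2 + X 0 * X 1 + C (X 1 ^ 2) * X 0 ^ 2 * X 1 + C (X 0 ^ 3) * X 0 * X 1,
        1 + X 0 ^ 2 * X 1 * X 2 ^ 2 + X 0 * X 1 ^ 2 * X 2 + C (X 1 ^ 2) * X 0 ^ 2 * X 1 * X 2 + C (X 0 ^ 3) * X 0 * X 1 ^ 2 * X 2] : Fin 3 → MvPolynomial (Fin 3) (MvPolynomial (Fin 2) k)) 1} = Ideal.map (Φ.symm : MvPolynomial (Fin 5) k →+* MvPolynomial (Fin 3) (MvPolynomial (Fin 2) k)) (Ideal.span {(X 4 ^ 2 + X 0 ^ 2 * X 2 ^ 2 * X 4 + X 0 * X 2 + X 0 ^ 2 * X 2 * X 3 ^ 2 + X 0 * X 1 ^ 3 * X 2 : MvPolynomial (Fin 5) k)}) := by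
    rw [Ideal.map_span, Set.image_singleton]
    have : Φ.symm (X 4 ^ 2 + X 0 ^ 2 * X 2 ^ 2 * X 4 + X 0 * X 2 + X 0 ^ 2 * X 2 * X 3 ^ 2 + X 0 * X 1 ^ 3 * X 2) = (![X 2 ^ 2 + X 0 ^ 2 * X 1 * X 2 + X 0 * X 1 ^ 2 + C (X 1 ^ 2) * X 0 * X 1 + C (X 0 ^ 3) * X 0 * X 1 ^ 2,
        X 2 ^ 2 + X 0 ^ 2 * X 1 ^ 2 * X 2 + X 0 * X 1 + C (X 1 ^ 2) * X 0 ^ 2 * X 1 + C (X 0 ^ 3) * X 0 * X 1,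
        1 + X 0 ^ 2 * X 1 * X 2 ^ 2 + X 0 * X 1 ^ 2 * X 2 + C (X 1 ^ 2) * X 0 ^ 2 * X 1 * X 2 + C (X 0 ^ 3) * X 0 * X 1 ^ 2 * X 2] : Fin 3 → MvPolynomial (Fin 3) (MvPolynomial (Fin 2) k)) 1 := by rw [← hGj, RingEquiv.symm_apply_apply]
    simp [this]
  exact hon_chart (MvPolynomial (Fin 2) k) (X 0) (X 1) _ rfl _ rfl (prime_F k _ rfl) (not_mem_span_X k _ rfl _ rfl) 1
    (fun Q₂ _ => E8Char5FiModel.clause_maximal_of_ringEquiv 2 (Ideal.quotientEquiv _ _ Φ.symm hIJ) 0 0 (map_zero _)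
      (fun Q₃ _ _ => LoopGermMCharts.clause_chart_c k _ rfl Q₃) Q₂ (Ideal.zero_mem Q₂))
    (MvPolynomial (Fin 5) k ⧸ Ideal.span {g}) Ψ _ _ (map_centre k _ g Ψ hΨ0 hΨ1 hΨ2) hΨ1.symm Q

set_option maxHeartbeats 1600000 in
-- §1 instantiated + one clause transport along the flattening
/-- ★★ **CHART `e` OF `Bl_{(a,c,e)} U_M` IS CURED** (`char k = 2`): every maximal ideal of `blowupAlgebra (x̄0, x̄2, x̄4) x̄4` satisfies the CM + Frobenius-closed
clause (`…LoopGermMCharts.clause_chart_e` through `Φ`, §1 `hon_chart` in the `k[X]`-presentation). [OURS; cite: Fedder1983, Thm. 1.12] -/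
theorem chartE_clause [CharP k 2] (g : MvPolynomial (Fin 5) k) (hg : g = X 4 ^ 2 + X 0 ^ 2 * X 2 * X 4 + X 0 * X 2 ^ 2 + X 0 ^ 2 * X 2 * X 3 ^ 2 + X 0 * X 1 ^ 3 * X 2 ^ 2)
    (Q : Ideal (blowupAlgebra (Ideal.span ({Ideal.Quotient.mk (Ideal.span {g}) (X 0), Ideal.Quotient.mk (Ideal.span {g}) (X 2), Ideal.Quotient.mk (Ideal.span {g}) (X 4)} : Set (MvPolynomial (Fin 5) k ⧸ Ideal.span {g}))) (Ideal.Quotient.mk (Ideal.span {g}) (X 4)))) [Q.IsMaximal] :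
    ∀ n₀ : ℕ, ringKrullDim (Localization.AtPrime Q) = n₀ → ∀ s : Fin n₀ → Localization.AtPrime Q,
      (Ideal.span (Set.range s)).radical.IsMaximal →
        RingTheory.Sequence.IsWeaklyRegular (Localization.AtPrime Q) (List.ofFn s) ∧
        ∀ y : Localization.AtPrime Q, (∃ n : ℕ, y ^ 2 ^ n ∈ Ideal.span
          ((fun z : Localization.AtPrime Q => z ^ 2 ^ n) '' (Ideal.span (Set.range s) : Set (Localization.AtPrime Q)))) → y ∈ Ideal.span (Set.range s) := by
  classical
  obtain ⟨Φ, h0, h1, h2, hb, hd, -⟩ := exists_flatten k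
  have hv := flatten_values k Φ h0 h1 h2 hb hd
  obtain ⟨Ψ, hΨ0, hΨ1, hΨ2, -, -⟩ := exists_presentationEquiv k _ rfl g hg
  have hGj : Φ ((![X 2 ^ 2 + X 0 ^ 2 * X 1 * X 2 + X 0 * X 1 ^ 2 + C (X 1 ^ 2) * X 0 * X 1 + C (X 0 ^ 3) * X 0 * X 1 ^ 2,
        X 2 ^ 2 + X 0 ^ 2 * X 1 ^ 2 * X 2 + X 0 * X 1 + C (X 1 ^ 2) * X 0 ^ 2 * X 1 + C (X 0 ^ 3) * X 0 * X 1,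
        1 + X 0 ^ 2 * X 1 * X 2 ^ 2 + X 0 * X 1 ^ 2 * X 2 + C (X 1 ^ 2) * X 0 ^ 2 * X 1 * X 2 + C (X 0 ^ 3) * X 0 * X 1 ^ 2 * X 2] : Fin 3 → MvPolynomial (Fin 3) (MvPolynomial (Fin 2) k)) 2) = 1 + X 0 ^ 2 * X 2 * X 4 ^ 2 + X 0 * X 2 ^ 2 * X 4 + X 0 ^ 2 * X 2 * X 3 ^ 2 * X 4 + X 0 * X 1 ^ 3 * X 2 ^ 2 * X 4 := hv.2.2.2
  have hIJ : Ideal.span {(![X 2 ^ 2 + X 0 ^ 2 * X 1 * X 2 + X 0 * X 1 ^ 2 + C (X 1 ^ 2) * X 0 * X 1 + C (X 0 ^ 3) * X 0 * X 1 ^ 2,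
        X 2 ^ 2 + X 0 ^ 2 * X 1 ^ 2 * X 2 + X 0 * X 1 + C (X 1 ^ 2) * X 0 ^ 2 * X 1 + C (X 0 ^ 3) * X 0 * X 1,
        1 + X 0 ^ 2 * X 1 * X 2 ^ 2 + X 0 * X 1 ^ 2 * X 2 + C (X 1 ^ 2) * X 0 ^ 2 * X 1 * X 2 + C (X 0 ^ 3) * X 0 * X 1 ^ 2 * X 2] : Fin 3 → MvPolynomial (Fin 3) (MvPolynomial (Fin 2) k)) 2} = Ideal.map (Φ.symm : MvPolynomial (Fin 5) k →+* MvPolynomial (Fin 3) (MvPolynomial (Fin 2) k)) (Ideal.span {(1 + X 0 ^ 2 * X 2 * X 4 ^ 2 + X 0 * X 2 ^ 2 * X 4 + X 0 ^ 2 * X 2 * X 3 ^ 2 * X 4 + X 0 * X 1 ^ 3 * X 2 ^ 2 * X 4 : MvPolynomial (Fin 5) k)}) := by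
    rw [Ideal.map_span, Set.image_singleton]
    have : Φ.symm (1 + X 0 ^ 2 * X 2 * X 4 ^ 2 + X 0 * X 2 ^ 2 * X 4 + X 0 ^ 2 * X 2 * X 3 ^ 2 * X 4 + X 0 * X 1 ^ 3 * X 2 ^ 2 * X 4) = (![X 2 ^ 2 + X 0 ^ 2 * X 1 * X 2 + X 0 * X 1 ^ 2 + C (X 1 ^ 2) * X 0 * X 1 + C (X 0 ^ 3) * X 0 * X 1 ^ 2,
        X 2 ^ 2 + X 0 ^ 2 * X 1 ^ 2 * X 2 + X 0 * X 1 + C (X 1 ^ 2) * X 0 ^ 2 * X 1 + C (X 0 ^ 3) * X 0 * X 1,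
        1 + X 0 ^ 2 * X 1 * X 2 ^ 2 + X 0 * X 1 ^ 2 * X 2 + C (X 1 ^ 2) * X 0 ^ 2 * X 1 * X 2 + C (X 0 ^ 3) * X 0 * X 1 ^ 2 * X 2] : Fin 3 → MvPolynomial (Fin 3) (MvPolynomial (Fin 2) k)) 2 := by rw [← hGj, RingEquiv.symm_apply_apply]
    simp [this]
  exact hon_chart (MvPolynomial (Fin 2) k) (X 0) (X 1) _ rfl _ rfl (prime_F k _ rfl) (not_mem_span_X k _ rfl _ rfl) 2
    (fun Q₂ _ => E8Char5FiModel.clause_maximal_of_ringEquiv 2 (Ideal.quotientEquiv _ _ Φ.symm hIJ) 0 0 (map_zero _)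
      (fun Q₃ _ _ => LoopGermMCharts.clause_chart_e k _ rfl Q₃) Q₂ (Ideal.zero_mem Q₂))
    (MvPolynomial (Fin 5) k ⧸ Ideal.span {g}) Ψ _ _ (map_centre k _ g Ψ hΨ0 hΨ1 hΨ2) hΨ2.symm Q

end LoopGerm

end Summit.ResolutionOfSingularities.ResolutionOfSingularities.Theorems.FInjectiveMacaulayfication.LoopGermMCure

end
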